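import Summits.QuantumFields.YangMills.Theorems.AlphaInputsT3ACv3StepLowMaxB3OfDeepPoints
import Literature.MathematicalPhysics.QuantumFieldTheory.Balaban1983to89.T3SmallLiftHistory
import HarnessLib

/-!
# `AlphaInputsT3ACv3StepLowMaxB3OfLeGamma` — THE (E1) LOWER ROW OF #23 WITH ITS THREE γ-SIZE ROWS DISCHARGED FROM ONE COUPLING ROW AT WEIGHT `max(B₃,1)` AND THE (E1) FLOOR
# (cell `ym3-torus`, (α)-row #23 `fibre57LowOn`; seat `ym-ust-19936-w8` g16, TWIN-WIDTH helper; `--supports stmt-QuantumFields-19936 --as helper`; sequel of ✓C `…v3StepLowMaxB3OfDeepPoints`; the `c = 1` ∕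
# print's-family twin is `ym3-torus-px20` g13's `…DeepFibrePointSizeRows` — disjoint statements)

WHAT.  ✓C `AlphaInputsT3AC.PkgCoreRows.fibre57LowOnAC_T3_maxB₃_of_deepPointRows` displays the three γ-size rows of the deep-fibre-point letter (✓`…DeepFibrePointOfRows.hdeep_of_rows`, px20 g13) at the
(E1) weight `c := max B₃ 1`: `hP3` (`143·((d+4)²∕4)²·α₀ ≤ ⅓`), `hP2` (`2α₀ ≤ 2δ_{SU(2)}∕((d+4)L)²`), `hwin` (`2α₀ < ε₁(k)`), `α₀ := c·ε₁(k+1)·L⁻²`.  THIS FILE discharges them AT A GENERAL WEIGHT `c`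
by threshold arithmetic on `ε₁(j) = θ(K − j)` ([Balaban1985UV3] (7) p.257):
* §1 `eps1Of_succ_le_sqrt_mul` (the ratio row `ε₁(k+1) ≤ √L·ε₁(k)`, lit ✓`T3SmallLiftHistory.sqrt_inv_mul_θBal_le_succ`); ★`hwin_of_floor` (`2c·√L < L²` ⟹ `hwin`; at `c = max B₃ 1` this is the (E1)
  floor «`2·max(B₃,1) < L^{3∕2}`»); `mul_eps1Of_le_of_le_gamma_c` (the coupling row AT WEIGHT `c`, `γ ≤ ((((4500·L⁵·c)⁻¹)∕(b₀Q₀(p₀)))²)²` ⟹ `c·ε₁(j) ≤ (4500·L⁵)⁻¹`, lit ✓`T3Thresholds.θBal_le_of_le_gamma`);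
  ★`hP3_hP2_of_le_gamma_c` (that row ⟹ `hP3 ∧ hP2`, `d = 3`, `L ≥ 2`).
* §2 ★★★ `fibre57LowOnAC_T3_maxB₃_of_le_gamma_c` = ✓C with `hP3 hP2 hwin` REPLACED by the coupling row at `c := max B₃ 1` (`hγc`) and the floor (`hfloor : 2·max(B₃,1)·√L < L²`) — the (E1) lower row of
  #23 at the rows record modulo {charts (✓inhabited), Gaussian datum, `hinv` (B0), (55)∕(58) pins (B0 DEFINER)} and TWO scalar side conditions.

HONEST SCOPE.  γ∕L arithmetic + one composition; def-free; nothing of [Balaban1985UV3] (37)∕(47)∕(57) beyond the cited rows, of row #23's pins, of the (α) data rows (0∕23), of (O‴χₛ), `HistoryTailL`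
(19936), EX, LOWB∘ or `YM3TorusSU2` is proved (rung R3 = SU(2) YM₃ on T³, a RECORD rung: NOT d = 4, NOT infinite volume, NOT a mass gap, NOT Clay; the Yang–Mills mass gap is NOT proved).  L-floor:
`2·max(B₃,1)·√L < L²` (displayed).
References: T. Bałaban, Commun. Math. Phys. **102** (1985) 255–275 [Balaban1985UV3] ((7) p.257, (47) p.267, (49) p.268); **98** (1985) 17–51 [Balaban1985Averaging] (Prop. 2 (52)–(54) p.26).
-/
set_option autoImplicit false

noncomputable section

namespace Summit.QuantumFields.YangMills.Theorems

open MeasureTheory Literature.MathematicalPhysics.QuantumFieldTheory.Balaban1983to89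
open Literature.MathematicalPhysics.QuantumFieldTheory.Balaban1983to89.GaugeField (GaugeInvariant gaugeAct)
open Literature.MathematicalPhysics.QuantumFieldTheory.Balaban1983to89.BlockAveraging (avgFun loopHol Idx)
open Literature.MathematicalPhysics.QuantumFieldTheory.Balaban1983to89.ExpMeanLog (expMeanLogSU deltaSU)
open Literature.MathematicalPhysics.QuantumFieldTheory.Balaban1983to89.T3ContinuumYM3Torus
open Literature.MathematicalPhysics.QuantumFieldTheory.Balaban1983to89.T3UnitScaleTilt (θBal)
open Literature.MathematicalPhysics.QuantumFieldTheory.Balaban1985CMP102 Literature.MathematicalPhysics.QuantumFieldTheory.Balaban1985CMP102.Setting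
open Summit.QuantumFields.Balaban3D.Carriers
open Summit.QuantumFields.Balaban3D.Proofs.Primitives
open Summit.QuantumFields.Balaban3D.Proofs.TowerAC Summit.QuantumFields.Balaban3D.Proofs.StandardAC Summit.QuantumFields.Balaban3D.Proofs.InputsAC
open Summit.QuantumFields.Balaban3D.Proofs.Bound55Masses (chiB)
open Summit.QuantumFields.Balaban3D.Proofs.GaussianNormalization (partZ normalized)
open Summit.QuantumFields.Balaban3D.Proofs.Thresholds (Q0 Q0_pos)
open Summit.QuantumFields.YangMills.Theorems.PinnedStep (Fibre57LowOnAC)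
open scoped NNReal ENNReal

/-! ## §1 Threshold arithmetic: the ratio row, the floor, the coupling row at weight `c` -/

namespace PinnedStepTrivPins

section SizeRows

variable {F : T3Family} {𝔠 : AlphaConsts F.L (suGroupModel 2).N}

/-- **THE RATIO ROW** `ε₁(k+1) ≤ √L·ε₁(k)` on a coupling window `0 < γ ≤ 1` (`ε₁(j) = θ(K−j)` and `√(L⁻¹)·θ(i) ≤ θ(i+1)`, lit ✓`sqrt_inv_mul_θBal_le_succ`). [cite: Balaban1985UV3, (7) p.257] -/
theorem eps1Of_succ_le_sqrt_mul (γ : ℝ) (hγ : 0 < γ) (hγ1 : γ ≤ 1) (K k : ℕ) (hk : k + 1 ≤ K) :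
    eps1Of (T3Scales F γ hγ hγ1 K) 𝔠.lane.carrier (k + 1) ≤ Real.sqrt (F.L : ℝ) * eps1Of (T3Scales F γ hγ hγ1 K) 𝔠.lane.carrier k := by
  have hL1 : 1 ≤ F.L := le_of_lt F.hL.2
  have hL : (0 : ℝ) < F.L := by exact_mod_cast (zero_lt_one.trans F.hL.2)
  rw [eps1Of_T3Scales_eq_of_le_one (𝔠 := 𝔠) γ hγ hγ1 K (k + 1) hk, eps1Of_T3Scales_eq_of_le_one (𝔠 := 𝔠) γ hγ hγ1 K k (by omega)]
  have h := T3SmallLiftHistory.sqrt_inv_mul_θBal_le_succ hL1 hγ hγ1 𝔠.b₀_pos.le 𝔠.p₀_pos.le (K - (k + 1))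
  rw [show K - (k + 1) + 1 = K - k by omega] at h
  have hs : Real.sqrt (F.L : ℝ) * Real.sqrt ((F.L : ℝ)⁻¹) = 1 := by
    rw [← Real.sqrt_mul hL.le, mul_inv_cancel₀ hL.ne', Real.sqrt_one]
  calc θBal F.L γ 𝔠.b₀ 𝔠.p₀ (K - (k + 1))
      = Real.sqrt (F.L : ℝ) * (Real.sqrt ((F.L : ℝ)⁻¹) * θBal F.L γ 𝔠.b₀ 𝔠.p₀ (K - (k + 1))) := by rw [← mul_assoc, hs, one_mul]
    _ ≤ Real.sqrt (F.L : ℝ) * θBal F.L γ 𝔠.b₀ 𝔠.p₀ (K - k) := mul_le_mul_of_nonneg_left h (Real.sqrt_nonneg _)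

/-- ★ **THE WINDOW ROW `hwin` FROM THE FLOOR `2c·√L < L²`**: `2·(c·ε₁(k+1)·L⁻²) < ε₁(k)` (ratio row + `ε₁(k) > 0`).  At `c = 1` the floor holds for every `L ≥ 2`; at `c = max B₃ 1` it is the
(E1) floor «`2·max(B₃,1) < L^{3∕2}`». [cite: Balaban1985UV3, (7) p.257 + (47) p.267] -/
theorem hwin_of_floor (γ : ℝ) (hγ : 0 < γ) (hγ1 : γ ≤ 1) (K k : ℕ) (hk : k + 1 ≤ K) {c : ℝ} (hc : 0 ≤ c)
    (hfloor : 2 * c * Real.sqrt (F.L : ℝ) < (F.L : ℝ) ^ 2) :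
    2 * (c * eps1Of (T3Scales F γ hγ hγ1 K) 𝔠.lane.carrier (k + 1) * ((F.L : ℝ)⁻¹) ^ 2) < eps1Of (T3Scales F γ hγ hγ1 K) 𝔠.lane.carrier k := by
  have hL : (0 : ℝ) < F.L := by exact_mod_cast (zero_lt_one.trans F.hL.2)
  have hε : 0 < eps1Of (T3Scales F γ hγ hγ1 K) 𝔠.lane.carrier k := PinnedStep.eps1Of_carrier_pos (S := T3Scales F γ hγ hγ1 K) 𝔠.lane k (by show k ≤ K; omega)
  have hr := eps1Of_succ_le_sqrt_mul (𝔠 := 𝔠) γ hγ hγ1 K k hk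
  have hinv : ((F.L : ℝ)⁻¹) ^ 2 = ((F.L : ℝ) ^ 2)⁻¹ := by rw [inv_pow]
  rw [hinv]
  have hL2 : (0 : ℝ) < (F.L : ℝ) ^ 2 := by positivity
  have hq : 2 * c * Real.sqrt (F.L : ℝ) / (F.L : ℝ) ^ 2 < 1 := (div_lt_one hL2).2 hfloor
  calc 2 * (c * eps1Of (T3Scales F γ hγ hγ1 K) 𝔠.lane.carrier (k + 1) * ((F.L : ℝ) ^ 2)⁻¹)
      ≤ 2 * (c * (Real.sqrt (F.L : ℝ) * eps1Of (T3Scales F γ hγ hγ1 K) 𝔠.lane.carrier k) * ((F.L : ℝ) ^ 2)⁻¹) := by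
        gcongr
    _ = (2 * c * Real.sqrt (F.L : ℝ) / (F.L : ℝ) ^ 2) * eps1Of (T3Scales F γ hγ hγ1 K) 𝔠.lane.carrier k := by ring
    _ < 1 * eps1Of (T3Scales F γ hγ hγ1 K) 𝔠.lane.carrier k := mul_lt_mul_of_pos_right hq hε
    _ = _ := one_mul _

/-- **THE COUPLING ROW AT WEIGHT `c`**: `γ ≤ ((((4500·L⁵·c)⁻¹)∕(b₀Q₀(p₀)))²)²` ⟹ `c·ε₁(j) ≤ (4500·L⁵)⁻¹` at every `j ≤ K` (`θ(i) ≤ σ` once `γ ≤ ((σ∕(b₀Q₀))²)²`, lit ✓`θBal_le_of_le_gamma`).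
[cite: Balaban1985UV3, (7) p.257] -/
theorem mul_eps1Of_le_of_le_gamma_c (γ : ℝ) (hγ : 0 < γ) (hγ1 : γ ≤ 1) {c : ℝ} (hc : 0 < c)
    (hγc : γ ≤ ((((4500 : ℝ) * (F.L : ℝ) ^ 5 * c)⁻¹ / (𝔠.b₀ * Q0 𝔠.p₀)) ^ 2) ^ 2) (K j : ℕ) (hj : j ≤ K) :
    c * eps1Of (T3Scales F γ hγ hγ1 K) 𝔠.lane.carrier j ≤ ((4500 : ℝ) * (F.L : ℝ) ^ 5)⁻¹ := by
  have hL1 : 1 ≤ F.L := le_of_lt F.hL.2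
  have hL : (0 : ℝ) < F.L := by exact_mod_cast (zero_lt_one.trans F.hL.2)
  have hσ : 0 ≤ ((4500 : ℝ) * (F.L : ℝ) ^ 5 * c)⁻¹ := by positivity
  have heps : eps1Of (T3Scales F γ hγ hγ1 K) 𝔠.lane.carrier j ≤ ((4500 : ℝ) * (F.L : ℝ) ^ 5 * c)⁻¹ := by
    rw [eps1Of_T3Scales_eq_of_le_one (𝔠 := 𝔠) γ hγ hγ1 K j hj]
    exact T3Thresholds.θBal_le_of_le_gamma hL1 𝔠.b₀_pos 𝔠.p₀_pos hσ hγ hγ1 hγc (K - j)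
  calc c * eps1Of (T3Scales F γ hγ hγ1 K) 𝔠.lane.carrier j ≤ c * ((4500 : ℝ) * (F.L : ℝ) ^ 5 * c)⁻¹ := mul_le_mul_of_nonneg_left heps hc.le
    _ = ((4500 : ℝ) * (F.L : ℝ) ^ 5)⁻¹ := by field_simp

/-- ★ **THE TWO PROP-2 SIZE ROWS `hP3`, `hP2` FROM THE COUPLING ROW AT WEIGHT `c`** (`d = 3`, `L ≥ 2`): with `c·ε₁(k+1) ≤ (4500·L⁵)⁻¹`,
`143·((d+4)²∕4)²·(c·ε₁(k+1)·L⁻²) ≤ 143·(49∕4)²∕(4500·L⁷) ≤ ⅓` and `2·(c·ε₁(k+1)·L⁻²) ≤ 2∕(4500·L⁷) ≤ (2∕3)∕(7L)² = 2·δ_{SU(2)}∕((d+4)L)²`. [cite: Balaban1985Averaging, Prop. 2 (52)–(54) p.26] -/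
theorem hP3_hP2_of_le_gamma_c (γ : ℝ) (hγ : 0 < γ) (hγ1 : γ ≤ 1) {c : ℝ} (hc : 0 < c)
    (hγc : γ ≤ ((((4500 : ℝ) * (F.L : ℝ) ^ 5 * c)⁻¹ / (𝔠.b₀ * Q0 𝔠.p₀)) ^ 2) ^ 2) (K k : ℕ) (hk : k + 1 ≤ K) :
    (143 * (((((F.P K).d + 4 : ℕ) : ℝ)) ^ 2 / 4) ^ 2) *
        (c * eps1Of (T3Scales F γ hγ hγ1 K) 𝔠.lane.carrier (k + 1) * ((F.L : ℝ)⁻¹) ^ 2) ≤ 1 / 3 ∧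
      2 * (c * eps1Of (T3Scales F γ hγ hγ1 K) 𝔠.lane.carrier (k + 1) * ((F.L : ℝ)⁻¹) ^ 2) ≤
        2 * deltaSU (Fin 2) / ((((F.P K).d + 4) * (F.P K).L : ℕ) : ℝ) ^ 2 := by
  have hL2 : (2 : ℝ) ≤ F.L := by exact_mod_cast F.hL.2
  have hL : (0 : ℝ) < F.L := by linarith
  have hce := mul_eps1Of_le_of_le_gamma_c (𝔠 := 𝔠) γ hγ hγ1 hc hγc K (k + 1) hk
  have hce0 : 0 ≤ c * eps1Of (T3Scales F γ hγ hγ1 K) 𝔠.lane.carrier (k + 1) :=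
    mul_nonneg hc.le (PinnedStep.eps1Of_carrier_pos (S := T3Scales F γ hγ hγ1 K) 𝔠.lane (k + 1) hk).le
  -- `c·ε₁(k+1)·L⁻² ≤ (4500·L⁷)⁻¹`
  have hx : c * eps1Of (T3Scales F γ hγ hγ1 K) 𝔠.lane.carrier (k + 1) * ((F.L : ℝ)⁻¹) ^ 2 ≤ ((4500 : ℝ) * (F.L : ℝ) ^ 7)⁻¹ := by
    calc c * eps1Of (T3Scales F γ hγ hγ1 K) 𝔠.lane.carrier (k + 1) * ((F.L : ℝ)⁻¹) ^ 2
        ≤ ((4500 : ℝ) * (F.L : ℝ) ^ 5)⁻¹ * ((F.L : ℝ)⁻¹) ^ 2 := mul_le_mul_of_nonneg_right hce (by positivity)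
      _ = ((4500 : ℝ) * (F.L : ℝ) ^ 7)⁻¹ := by rw [inv_pow, ← mul_inv]; ring
  have hx0 : 0 ≤ c * eps1Of (T3Scales F γ hγ hγ1 K) 𝔠.lane.carrier (k + 1) * ((F.L : ℝ)⁻¹) ^ 2 := mul_nonneg hce0 (by positivity)
  have hL7 : (128 : ℝ) ≤ (F.L : ℝ) ^ 7 := by nlinarith [pow_le_pow_left₀ (by norm_num : (0:ℝ) ≤ 2) hL2 7]
  have h7 : ((4500 : ℝ) * (F.L : ℝ) ^ 7)⁻¹ ≤ ((4500 : ℝ) * 128)⁻¹ := inv_anti₀ (by positivity) (by nlinarith)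
  rw [T3Family.P_d, show (F.P K).L = F.L from rfl]
  refine ⟨?_, ?_⟩
  · -- `143·(49/4)²·x ≤ 1/3`
    have hnum : (143 * ((((3 + 4 : ℕ) : ℝ)) ^ 2 / 4) ^ 2) * ((4500 : ℝ) * 128)⁻¹ ≤ 1 / 3 := by norm_num
    calc (143 * ((((3 + 4 : ℕ) : ℝ)) ^ 2 / 4) ^ 2) * (c * eps1Of (T3Scales F γ hγ hγ1 K) 𝔠.lane.carrier (k + 1) * ((F.L : ℝ)⁻¹) ^ 2)
        ≤ (143 * ((((3 + 4 : ℕ) : ℝ)) ^ 2 / 4) ^ 2) * ((4500 : ℝ) * 128)⁻¹ := mul_le_mul_of_nonneg_left (hx.trans h7) (by positivity)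
      _ ≤ 1 / 3 := hnum
  · -- `2x ≤ 2·δ₂/(7L)²`
    have hδ : (1 : ℝ) / 3 ≤ deltaSU (Fin 2) := by
      unfold deltaSU; rw [Fintype.card_fin]
      have hπ : (3 : ℝ) < Real.pi := Real.pi_gt_three
      refine le_min le_rfl ?_
      push_cast
      rw [le_div_iff₀ (by norm_num : (0 : ℝ) < 2)]
      linarith
    have h7L : (0 : ℝ) < (((3 + 4) * F.L : ℕ) : ℝ) := by
      have h := F.hL.2
      exact_mod_cast Nat.mul_pos (by norm_num) (by omega)
    have hL2' : (0 : ℝ) < (((3 + 4) * F.L : ℕ) : ℝ) ^ 2 := by positivity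
    -- `2/(4500 L⁷) ≤ (2/3)/(49 L²)`
    have hcmp : 2 * ((4500 : ℝ) * (F.L : ℝ) ^ 7)⁻¹ ≤ 2 * (1 / 3) / (((3 + 4) * F.L : ℕ) : ℝ) ^ 2 := by
      push_cast
      rw [show 2 * ((4500 : ℝ) * (F.L : ℝ) ^ 7)⁻¹ = 2 / ((4500 : ℝ) * (F.L : ℝ) ^ 7) from by ring,
        div_le_div_iff₀ (by positivity) (pow_pos (mul_pos (by norm_num : (0 : ℝ) < 7) hL) 2)]
      have hL5 : (32 : ℝ) ≤ (F.L : ℝ) ^ 5 := by nlinarith [pow_le_pow_left₀ (by norm_num : (0:ℝ) ≤ 2) hL2 5]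
      nlinarith
    calc 2 * (c * eps1Of (T3Scales F γ hγ hγ1 K) 𝔠.lane.carrier (k + 1) * ((F.L : ℝ)⁻¹) ^ 2)
        ≤ 2 * ((4500 : ℝ) * (F.L : ℝ) ^ 7)⁻¹ := by linarith
      _ ≤ 2 * (1 / 3) / (((3 + 4) * F.L : ℕ) : ℝ) ^ 2 := hcmp
      _ ≤ 2 * deltaSU (Fin 2) / (((3 + 4) * F.L : ℕ) : ℝ) ^ 2 := div_le_div_of_nonneg_right (by linarith) hL2'.le

end SizeRows

end PinnedStepTrivPins

/-! ## §2 At the rows record: the (E1) lower row with two scalar side conditions -/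

namespace AlphaInputsT3AC.PkgCoreRows

variable {F : T3Family} {𝔠 : AlphaConsts F.L (suGroupModel 2).N} {γ : ℝ} {hγ : 0 < γ} {hγ1 : γ ≤ (min 𝔠.gamma0 1) ^ 2} {K : ℕ}
variable (q : AlphaInputsT3AC.PkgCoreRows F 𝔠 γ hγ hγ1 K)

/-- ★★★ **THE (E1) LOWER ROW AT THE ROWS RECORD WITH TWO SCALAR SIDE CONDITIONS** — ✓C `fibre57LowOnAC_T3_maxB₃_of_deepPointRows` with its three size rows DISCHARGED from the coupling row at
weight `max B₃ 1` (`hγc : γ ≤ ((((4500·L⁵·max(B₃,1))⁻¹)∕(b₀Q₀(p₀)))²)²`) and the (E1) floor (`hfloor : 2·max(B₃,1)·√L < L²`).  Displayed residue: charts (✓inhabited), Gaussian datum, `hinv` (B0),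
the (55)∕(58) pins (B0 DEFINER). [cite: Balaban1985UV3, (37) p.265 + (47) p.267 + (49)–(58) pp.268–270 + p.272 L32–33] [cite: Balaban1985Averaging, Prop. 2 (52)–(54) p.26] -/
theorem fibre57LowOnAC_T3_maxB₃_of_le_gamma_c (ha₁ : ∀ i, θBal F.L γ 𝔠.b₀ 𝔠.p₀ i ≤ q.a₁)
    (hγs : γ ≤ ((((4500 : ℝ) * (F.L : ℝ) ^ 5)⁻¹ / (𝔠.b₀ * Q0 𝔠.p₀)) ^ 2) ^ 2)
    (hγc : γ ≤ ((((4500 : ℝ) * (F.L : ℝ) ^ 5 * max 𝔠.B₃ 1)⁻¹ / (𝔠.b₀ * Q0 𝔠.p₀)) ^ 2) ^ 2)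
    (hfloor : 2 * max 𝔠.B₃ 1 * Real.sqrt (F.L : ℝ) < (F.L : ℝ) ^ 2)
    (k : ℕ) (hk : k + 1 ≤ K)
    (Φ : GaugeField (F.P K) (k + 1) (Matrix.specialUnitaryGroup (Fin 2) ℂ) × GaugeField (F.P K) k (Matrix.specialUnitaryGroup (Fin 2) ℂ) →
      GaugeField (F.P K) k (Matrix.specialUnitaryGroup (Fin 2) ℂ))
    (J : GaugeField (F.P K) (k + 1) (Matrix.specialUnitaryGroup (Fin 2) ℂ) × GaugeField (F.P K) k (Matrix.specialUnitaryGroup (Fin 2) ℂ) → ℝ≥0)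
    (T : Set (GaugeField (F.P K) (k + 1) (Matrix.specialUnitaryGroup (Fin 2) ℂ) × GaugeField (F.P K) k (Matrix.specialUnitaryGroup (Fin 2) ℂ)))
    (hΦ : Measurable Φ) (hJ : Measurable J) (hT : MeasurableSet T)
    (hmap : ((((fieldMeasure (F.P K) (k + 1) (Matrix.specialUnitaryGroup (Fin 2) ℂ)).prod
        (fieldMeasure (F.P K) k (Matrix.specialUnitaryGroup (Fin 2) ℂ))).restrict T).withDensity (fun z => (J z : ℝ≥0∞))).map Φ =
      (fieldMeasure (F.P K) k (Matrix.specialUnitaryGroup (Fin 2) ℂ)).restrict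
        {U : GaugeField (F.P K) k (Matrix.specialUnitaryGroup (Fin 2) ℂ) |
          ∀ c i, dist1 (loopHol U c i) < ((Fintype.card (Idx (F.P K)) : ℝ))⁻¹ / 10})
    (hfib : ∀ z ∈ T, avgFun (expMeanLogSU (n := Fin 2)) (Φ z) = z.1) (N lσ dg : ℝ)
    (q_1 : GaugeField (F.P K) (k + 1) (Matrix.specialUnitaryGroup (Fin 2) ℂ) → GaugeField (F.P K) k (Matrix.specialUnitaryGroup (Fin 2) ℂ) → ℝ)
    (hqm : ∀ V, Measurable (q_1 V)) (hZ : ∀ V, 0 < partZ (fieldMeasure (F.P K) k (Matrix.specialUnitaryGroup (Fin 2) ℂ)) (q_1 V))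
    (hinv : GaugeInvariant (fun U : GaugeField (F.P K) k (Matrix.specialUnitaryGroup (Fin 2) ℂ) =>
      Real.exp (-((towerOfAC 𝔠.lane q.X q.𝔖).mainT k (Hist.triv (F.P K) k) U) + (towerOfAC 𝔠.lane q.X q.𝔖).Pint k (Hist.triv (F.P K) k) U)))
    (hσ : (piecesAC 𝔠.lane q.X q.𝔖 k).logσ₀ = lσ) (hdg : (piecesAC 𝔠.lane q.X q.𝔖 k).dg = dg)
    (hstar : (piecesAC 𝔠.lane q.X q.𝔖 k).starB (Hist.triv (F.P K) (k + 1)) = N)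
    (hZU : ∀ V, (piecesAC 𝔠.lane q.X q.𝔖 k).logZU (Hist.triv (F.P K) (k + 1)) V =
      Real.log (partZ (fieldMeasure (F.P K) k (Matrix.specialUnitaryGroup (Fin 2) ℂ)) (q_1 V)))
    (hFl : ∀ V, (piecesAC 𝔠.lane q.X q.𝔖 k).logFl (Hist.triv (F.P K) (k + 1)) V =
      Real.log (∫ U', (Real.exp (-((lσ + dg * Real.log ((T3Scales F γ hγ (hγ1.trans (sq_min_one_le _ 𝔠.gamma0_pos)) K).gk k)) * N)) * T.indicator (fun z => (J z : ℝ)) (V, U')) *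
              chiB 𝔠.lane.carrier.M₁ (rcolOf (T3Scales F γ hγ (hγ1.trans (sq_min_one_le _ 𝔠.gamma0_pos)) K) 𝔠.lane.carrier) (eps1Of (T3Scales F γ hγ (hγ1.trans (sq_min_one_le _ 𝔠.gamma0_pos)) K) 𝔠.lane.carrier) k
                (Hist.triv (F.P K) (k + 1)) (Φ (V, U')) *
              Real.exp (-((towerOfAC 𝔠.lane q.X q.𝔖).mainT k (Hist.triv (F.P K) k) (Φ (V, U')) -
                    (towerOfAC 𝔠.lane q.X q.𝔖).mainT (k + 1) (Hist.triv (F.P K) (k + 1)) V)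
                + ((towerOfAC 𝔠.lane q.X q.𝔖).Pint k (Hist.triv (F.P K) k) (Φ (V, U')) - (piecesAC 𝔠.lane q.X q.𝔖 k).Pold (Hist.triv (F.P K) (k + 1)) V)
                + q_1 V U')
            ∂(normalized (fieldMeasure (F.P K) k (Matrix.specialUnitaryGroup (Fin 2) ℂ)) (q_1 V)))) :
    Fibre57LowOnAC 𝔠.lane q.X q.𝔖
      (fun j => {V : GaugeField (F.P K) j (Matrix.specialUnitaryGroup (Fin 2) ℂ) |
          PlaqSmall (eps1Of (T3Scales F γ hγ (hγ1.trans (sq_min_one_le _ 𝔠.gamma0_pos)) K) 𝔠.lane.carrier j) V} ∩ PinnedStep.chiMinAC 𝔠.lane q.X (max 𝔠.B₃ 1) j) k := by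
  have hc : (0 : ℝ) < max 𝔠.B₃ 1 := lt_max_of_lt_right one_pos
  obtain ⟨hP3, hP2⟩ := PinnedStepTrivPins.hP3_hP2_of_le_gamma_c (𝔠 := 𝔠) γ hγ (hγ1.trans (sq_min_one_le _ 𝔠.gamma0_pos)) hc hγc K k hk
  have hwin := PinnedStepTrivPins.hwin_of_floor (𝔠 := 𝔠) γ hγ (hγ1.trans (sq_min_one_le _ 𝔠.gamma0_pos)) K k hk hc.le hfloor
  exact q.fibre57LowOnAC_T3_maxB₃_of_deepPointRows ha₁ hγs k hk hP3 hP2 hwin Φ J T hΦ hJ hT hmap hfib N lσ dg q_1 hqm hZ hinv hσ hdg hstar hZU hFl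

end AlphaInputsT3AC.PkgCoreRows

end Summit.QuantumFields.YangMills.Theorems

end
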